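import Mathlib
import Summits.Schanuel.Schanuel.Theorems.AclSubsetLogFreeCore.Negative.ExpAclField
import Summits.Schanuel.Schanuel.Theorems.AclSubsetLogFreeCore.Negative.ExpAclDefinability
import Literature.ModelTheory.ExponentialFields.DefinabilityParams

/-!
# The WINDOW SELECTOR for (S*) — crux stmt-Schanuel-0969 `RigidCore.MinimalCounterexampleInAcl`

Line `kernel-arithmetic-selection`, stub `stub_selectorWindow` (gen 12 window selector),
`--supports stmt-Schanuel-0969`.

Let `E ⊆ ℂ` be `∅`-definable in `ℂ_exp = (ℂ, +, ·, −, 0, 1, exp)` and let `G ⊆ ℤ` be a finite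
"translate pattern".  The set of WINDOW POSITIONS
`S = {s | ∃ t ∈ {±2πi}, ∀ g ∈ G, s + t·g ∈ E}`
is `∅`-definable (the kernel generators `±2πi` are `∅`-definable, Kirby–Macintyre–Onshuus 2012
§2.3, tree `definable_mem_kerGenSet`; integer numerals are terms), and it is contained in the
union of the two one-signed pattern sets `{s | ∀ g ∈ G, s + 2πi g ∈ E}`,
`{s | ∀ g ∈ G, s − 2πi g ∈ E}`.  Hence, if both of these are finite, `S` is a finite
`∅`-definable set, so `S ⊆ acl^{ℂ_exp}(∅) = expAcl`; if the pattern occurs at `u + 2πi k₀`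
(`u + 2πi (k₀ + g) ∈ E` for `g ∈ G`) then `u + 2πi k₀ ∈ S ⊆ acl(∅)` and, `acl(∅)` being a
subring of `ℂ` containing `2πi` and `ℤ` (tree `ExpAclField`), `u ∈ acl(∅)`.

This is the selector used in the mixed sector of the rank-2 case of (S*): `acl`-membership of a
coordinate is obtained WITHOUT finiteness of the mate set, from finite recurrence of a window of
hits on the coset `u + 2πiℤ`.

## References

* [KirbyMacintyreOnshuus2012] J. Kirby, A. Macintyre, A. Onshuus, *The algebraic numbers definable
  in various exponential fields*, J. Inst. Math. Jussieu 11 (2012) 825–834, arXiv:1101.4224, §2.3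
  (`±2πi` is `∅`-definable in any exponential field with cyclic kernel).
* [Marker2002] D. Marker, *Model Theory: An Introduction*, Springer GTM 217, §1.3 (`acl`).
-/

noncomputable section

set_option linter.dupNamespace false

open Complex Set FirstOrder

namespace Summit.Schanuel.Schanuel.Cruxes.MinimalCounterexampleInAcl.KernelArithmeticSelection

open Literature.ModelTheory.ExponentialFields
open Summit.Schanuel.Schanuel.Theorems.AclSubsetLogFreeCore.Negative

/-- The window-position set `{s | ∃ t ∈ {±2πi}, ∀ g ∈ G, s + t·g ∈ E}` lies in the union of the
two one-signed pattern sets (the kernel generators are exactly `±2πi`, KMO 2012 §2.3, tree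
`mem_kerGenSet_iff`). [cite: KirbyMacintyreOnshuus2012, §2] -/
theorem windowSet_subset_union (E : Set ℂ) (G : Finset ℤ) :
    {s : ℂ | ∃ t : ℂ, t ∈ kerGenSet ∧ ∀ g ∈ G, s + t * (g : ℂ) ∈ E} ⊆
      {s : ℂ | ∀ g ∈ G, s + 2 * ↑Real.pi * Complex.I * (g : ℂ) ∈ E} ∪
        {s : ℂ | ∀ g ∈ G, s - 2 * ↑Real.pi * Complex.I * (g : ℂ) ∈ E} := by
  rintro s ⟨t, ht, hs⟩
  rcases mem_kerGenSet_iff.1 ht with rfl | rfl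
  · exact Or.inl hs
  · refine Or.inr fun g hg => ?_
    have h := hs g hg
    rwa [neg_mul, ← sub_eq_add_neg] at h

/-- The window-position set of an `∅`-definable `E ⊆ ℂ` is `∅`-definable: `t ∈ {±2πi}` is a
parameter-free first-order condition (KMO 2012 §2.3, tree `definable_mem_kerGenSet`) and the
pattern condition is a finite conjunction of atoms `s + t·g ∈ E` with integer numerals `g`.
[cite: KirbyMacintyreOnshuus2012, §2] -/
theorem definable₁_windowSet {E : Set ℂ}
    (hE : Set.Definable₁ (∅ : Set ℂ) Language.expRing E) (G : Finset ℤ) :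
    Set.Definable₁ (∅ : Set ℂ) Language.expRing
      {s : ℂ | ∃ t : ℂ, t ∈ kerGenSet ∧ ∀ g ∈ G, s + t * (g : ℂ) ∈ E} := by
  have hd : (∅ : Set ℂ).Definable Language.expRing
      {v : Fin 1 → ℂ | ∃ t : ℂ, t ∈ kerGenSet ∧ ∀ g ∈ G, v 0 + t * (g : ℂ) ∈ E} := by
    refine definable_setOf_exists_params (definable_setOf_and_params ?_ ?_)
    · exact definable_mem_kerGenSet (definableFun_proj_params _)
    · have hG : (∅ : Set ℂ).Definable Language.expRing
          (⋂ g ∈ G, {w : Fin 1 ⊕ Unit → ℂ | w (Sum.inl 0) + w (Sum.inr ()) * (g : ℂ) ∈ E}) :=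
        Set.definable_biInter_finset (fun g => definable_mem_of_definable₁ hE
          (definableFun_add' (definableFun_proj_params _)
            (definableFun_mul' (definableFun_proj_params _) (definableFun_intCast' g)))) G
      convert hG using 1
      ext w
      simp only [Set.mem_setOf_eq, Set.mem_iInter]
  have e : {x : Fin 1 → ℂ | x 0 ∈ {s : ℂ | ∃ t : ℂ, t ∈ kerGenSet ∧ ∀ g ∈ G, s + t * (g : ℂ) ∈ E}} =
      {v : Fin 1 → ℂ | ∃ t : ℂ, t ∈ kerGenSet ∧ ∀ g ∈ G, v 0 + t * (g : ℂ) ∈ E} := rfl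
  unfold Set.Definable₁
  rw [e]
  exact hd

/-- **Stub S2 — THE WINDOW SELECTOR (gen 12).**  If `E ⊆ ℂ` is `∅`-definable in `ℂ_exp`, the
finite pattern `G ∋ 0` occurs in `E` at `u + 2πi k₀` (`u + 2πi (k₀ + g) ∈ E` for all `g ∈ G`),
and both one-signed pattern sets `{s | ∀ g ∈ G, s ± 2πi g ∈ E}` are finite, then
`u ∈ acl^{ℂ_exp}(∅)`: the window-position set is a finite `∅`-definable set containing
`u + 2πi k₀`, and `acl(∅)` is a subring containing `2πi` and `ℤ`. [cite: KirbyMacintyreOnshuus2012, §2] -/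
theorem stub_selectorWindow : ∀ (E : Set ℂ) (u : ℂ) (G : Finset ℤ) (k₀ : ℤ), Set.Definable₁ (∅ : Set ℂ) Literature.ModelTheory.ExponentialFields.Language.expRing E → (0 : ℤ) ∈ G → (∀ g ∈ G, u + 2 * ↑Real.pi * Complex.I * ((k₀ + g : ℤ) : ℂ) ∈ E) → Set.Finite {s : ℂ | ∀ g ∈ G, s + 2 * ↑Real.pi * Complex.I * (g : ℂ) ∈ E} → Set.Finite {s : ℂ | ∀ g ∈ G, s - 2 * ↑Real.pi * Complex.I * (g : ℂ) ∈ E} → u ∈ Summit.Schanuel.Schanuel.Theorems.AclSubsetLogFreeCore.Negative.expAcl := by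
  intro E u G k₀ hE _ hwin hfinP hfinN
  -- the window-position set is a finite `∅`-definable set containing `u + 2πi k₀`
  have hmem : u + 2 * ↑Real.pi * Complex.I * (k₀ : ℂ) ∈
      {s : ℂ | ∃ t : ℂ, t ∈ kerGenSet ∧ ∀ g ∈ G, s + t * (g : ℂ) ∈ E} := by
    refine ⟨2 * ↑Real.pi * Complex.I, mem_kerGenSet_iff.2 (Or.inl rfl), fun g hg => ?_⟩
    have e : u + 2 * ↑Real.pi * Complex.I * (k₀ : ℂ) + 2 * ↑Real.pi * Complex.I * (g : ℂ) =
        u + 2 * ↑Real.pi * Complex.I * ((k₀ + g : ℤ) : ℂ) := by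
      push_cast; ring
    rw [e]
    exact hwin g hg
  have h1 : u + 2 * ↑Real.pi * Complex.I * (k₀ : ℂ) ∈ expAcl :=
    ⟨_, (hfinP.union hfinN).subset (windowSet_subset_union E G), definable₁_windowSet hE G,
      hmem⟩
  have h2 : -(2 * ↑Real.pi * Complex.I * (k₀ : ℂ)) ∈ expAcl :=
    neg_mem_expAcl (mul_mem_expAcl two_pi_I_mem_expAcl (intCast_mem_expAcl k₀))
  have h3 := add_mem_expAcl h1 h2
  rwa [add_neg_cancel_right] at h3

end Summit.Schanuel.Schanuel.Cruxes.MinimalCounterexampleInAcl.KernelArithmeticSelection
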